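import Literature.Geometry.Riemannian.CurveTubeSecondOrder
import Literature.Geometry.Lorentzian.CovariantDerivAlongLinear
import Mathlib.Analysis.InnerProductSpace.Dual
import HarnessLib

/-!
# The second-order data of the tube map: lifts, symmetry, linearity, and the metric derivative on the axis

Topic `Geometry/Riemannian`. Continuing `CurveTubeSecondOrder.lean`. Write
`A_v(z, u) = D_s(dΦ_{v+sz} u)|₀` for the covariant derivative, along `s ↦ Φ(v + sz)`, of the field
`s ↦ dΦ_{v+sz}(u)` (`Φ` the tube map of a framed curve). This file records the structural
properties consumed by the linear algebra of `AxisChristoffelForm.lean`: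

* `mdifferentiableAt_lift_mfderiv_tubeMap` — the lift of `s ↦ dΦ_{v+sz}(u)` is differentiable
  (a partial velocity of a `C^∞` two-parameter map);
* `covariantDerivAlong_mfderiv_tubeMap_symm` — **`A_v(z, u) = A_v(u, z)`** (symmetry lemma
  `D_s ∂_t = D_t ∂_s` for `(s, t) ↦ Φ(v + sz + tu)`);
* `covariantDerivAlong_mfderiv_tubeMap_add`, `covariantDerivAlong_mfderiv_tubeMap_smul` —
  linearity in `u` (linearity of `dΦ` and of the induced covariant derivative);
* `hasDerivAt_val_mfderiv_tubeMap_axis` — **on the axis, in Riesz form**: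
  `d/ds|₀ g(dΦ_{x₁ε₀+sz} u, dΦ_{x₁ε₀+sz} w) = ⟪B z u, w⟫ + ⟪u, B z w⟫` with
  `⟪B z u, w⟫ = g(A(z, u), e(x₁) w)` (`hasDerivAt_val_mfderiv_tubeMap` and `dΦ = e` on the axis),
  the hypothesis `hD` of `ChristoffelOfDerivative.christoffel_eq_of_fderiv_eq` for the tube metric.

## References

* J. M. Lee, *Introduction to Riemannian Manifolds*, 2nd ed. (2018), Prop. 5.26.
  [cite: LeeRiemannianManifolds2018, Prop. 5.26]
* A. Weinstein, Ann. of Math. (2) 87 (1968), 29–41. [cite: Weinstein1968]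

Tags: [FermiCoordinates] [TubeMap] [Weinstein1968]
-/

noncomputable section

open Bundle Set Filter Function InnerProductSpace
open scoped Manifold ContDiff Topology RealInnerProductSpace

namespace Literature.Geometry.Riemannian

open Literature.Geometry.Lorentzian
open Literature.Geometry.Lorentzian.PseudoRiemannianMetric

variable {V : Type*} [NormedAddCommGroup V] [InnerProductSpace ℝ V]
  {E : Type*} [NormedAddCommGroup E] [NormedSpace ℝ E] {H : Type*} [TopologicalSpace H]
  {I : ModelWithCorners ℝ E H} {M : Type*} [TopologicalSpace M] [ChartedSpace H M]
  [IsManifold I ∞ M] [FiniteDimensional ℝ E] [CompleteSpace E] [T2Space M] [BoundarylessManifold I M]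
  {cov : CovariantDerivative I E (TangentSpace I : M → Type _)}
  [CovariantDerivative.ContMDiffCovariantDerivative cov 1]
  [CovariantDerivative.ContMDiffCovariantDerivative cov ((⊤ : ℕ∞) : ℕ∞ω)]
  {c : ℝ → M} {e : Π t : ℝ, V →L[ℝ] TangentSpace I (c t)} {ε₀ : V}

/-! ### The lift of `s ↦ dΦ_{v+sz}(u)` is differentiable -/

/-- **The lift of the field `s ↦ dΦ_{v+sz}(u)` along `s ↦ Φ(v + sz)` is differentiable at `0`**:
it is the lift of the partial velocity `∂_t|₀` of the `C^∞` two-parameter map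
`(t, s) ↦ Φ(v + sz + tu)` (`mdifferentiableAt_lift_velocity_curry_left`). [folklore] -/
theorem mdifferentiableAt_lift_mfderiv_tubeMap (hc : IsGeodesicallyComplete cov)
    (hs : ContMDiff (𝓘(ℝ, ℝ).prod 𝓘(ℝ, V)) I.tangent ∞
      (fun q : ℝ × V ↦ (TotalSpace.mk' E (c q.1) (e q.1 q.2) : TangentBundle I M)))
    (v z u : V) :
    MDifferentiableAt 𝓘(ℝ, ℝ) I.tangent
      (fun s : ℝ ↦ (TotalSpace.mk' E
        (expMap cov (c ⟪ε₀, v + s • z⟫) (e ⟪ε₀, v + s • z⟫ (v + s • z - ⟪ε₀, v + s • z⟫ • ε₀)))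
        (mfderiv 𝓘(ℝ, V) I (fun v : V ↦ expMap cov (c ⟪ε₀, v⟫) (e ⟪ε₀, v⟫ (v - ⟪ε₀, v⟫ • ε₀)))
          (v + s • z) u) : TangentBundle I M)) 0 := by
  set Φ : V → M := fun v : V ↦ expMap cov (c ⟪ε₀, v⟫) (e ⟪ε₀, v⟫ (v - ⟪ε₀, v⟫ • ε₀)) with hΦ
  have hΦd : ∀ v, MDifferentiableAt 𝓘(ℝ, V) I Φ v := fun v ↦
    ((contMDiff_tubeMap (cov := cov) hc hs) v).mdifferentiableAt (by simp)
  set x : ℝ → ℝ → M := fun t s ↦ Φ (v + s • z + t • u) with hx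
  have hxs := contMDiff_uncurry_tubeMap_slice (cov := cov) (ε₀ := ε₀) hc hs v z u
  have h2 : (2 : ℕ∞ω) ≤ ∞ := WithTop.coe_le_coe.2 le_top
  have h := mdifferentiableAt_lift_velocity_curry_left ((hxs (0, 0)).of_le h2)
  have hfun : (fun s : ℝ ↦ (TotalSpace.mk' E (x 0 s) (velocity I (fun t ↦ x t s) 0) :
      TangentBundle I M)) =
      fun s : ℝ ↦ (TotalSpace.mk' E (Φ (v + s • z)) (mfderiv 𝓘(ℝ, V) I Φ (v + s • z) u) :
        TangentBundle I M) := by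
    funext s
    have hb : x 0 s = Φ (v + s • z) := by simp only [hx, zero_smul, add_zero]
    have hv' : (velocity I (fun t ↦ x t s) 0 : E) = mfderiv 𝓘(ℝ, V) I Φ (v + s • z) u :=
      velocity_comp_lineAt_zero (hΦd _) u
    revert hv'
    rw [show (fun t ↦ x t s) = fun t : ℝ ↦ Φ (v + s • z + t • u) from rfl]
    intro hv'
    -- equality in `TM` from equality of base points and of the vectors read in `E`
    exact TotalSpace.ext hb (heq_of_eq hv')
  rw [hfun] at h
  exact h

/-! ### Symmetry and linearity of `A_v(z, u) = D_s(dΦ_{v+sz} u)|₀` -/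

/-- **Symmetry `A_v(z, u) = A_v(u, z)`**: the symmetry lemma `D_s ∂_t = D_t ∂_s` for the `C^∞`
two-parameter map `(s, t) ↦ Φ(v + sz + tu)` at `(0, 0)` (torsion-free `cov`).
[cite: ONeill1983, Ch. 4, Prop. 44 (1)] -/
theorem covariantDerivAlong_mfderiv_tubeMap_symm (htors : cov.torsion = 0)
    (hc : IsGeodesicallyComplete cov)
    (hs : ContMDiff (𝓘(ℝ, ℝ).prod 𝓘(ℝ, V)) I.tangent ∞
      (fun q : ℝ × V ↦ (TotalSpace.mk' E (c q.1) (e q.1 q.2) : TangentBundle I M)))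
    (v z u : V) :
    covariantDerivAlong cov
      (fun s : ℝ ↦ expMap cov (c ⟪ε₀, v + s • z⟫) (e ⟪ε₀, v + s • z⟫ (v + s • z - ⟪ε₀, v + s • z⟫ • ε₀)))
      (fun s : ℝ ↦ mfderiv 𝓘(ℝ, V) I
        (fun v : V ↦ expMap cov (c ⟪ε₀, v⟫) (e ⟪ε₀, v⟫ (v - ⟪ε₀, v⟫ • ε₀))) (v + s • z) u) 0 =
    covariantDerivAlong cov
      (fun s : ℝ ↦ expMap cov (c ⟪ε₀, v + s • u⟫) (e ⟪ε₀, v + s • u⟫ (v + s • u - ⟪ε₀, v + s • u⟫ • ε₀)))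
      (fun s : ℝ ↦ mfderiv 𝓘(ℝ, V) I
        (fun v : V ↦ expMap cov (c ⟪ε₀, v⟫) (e ⟪ε₀, v⟫ (v - ⟪ε₀, v⟫ • ε₀))) (v + s • u) z) 0 := by
  set Φ : V → M := fun v : V ↦ expMap cov (c ⟪ε₀, v⟫) (e ⟪ε₀, v⟫ (v - ⟪ε₀, v⟫ • ε₀)) with hΦ
  have hΦd : ∀ v, MDifferentiableAt 𝓘(ℝ, V) I Φ v := fun v ↦
    ((contMDiff_tubeMap (cov := cov) hc hs) v).mdifferentiableAt (by simp)
  -- the slice with `s`-lines in the direction `z` and `t`-lines in the direction `u`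
  set x : ℝ → ℝ → M := fun s t ↦ Φ (v + s • z + t • u) with hx
  have hxs : ContMDiff (𝓘(ℝ, ℝ).prod 𝓘(ℝ, ℝ)) I ∞ (uncurry x) := by
    have hA : ContMDiff (𝓘(ℝ, ℝ).prod 𝓘(ℝ, ℝ)) 𝓘(ℝ, V) ∞
        (fun q : ℝ × ℝ ↦ v + q.1 • z + q.2 • u) :=
      (contMDiff_const.add (contMDiff_fst.smul contMDiff_const)).add
        (contMDiff_snd.smul contMDiff_const)
    exact (contMDiff_tubeMap (cov := cov) hc hs).comp hA
  have h2 : (2 : ℕ∞ω) ≤ ∞ := WithTop.coe_le_coe.2 le_top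
  have hsymm := covariantDerivAlong_velocity_comm cov htors ((hxs (0, 0)).of_le h2)
  -- identify the four ingredients
  have hLc : (fun s : ℝ ↦ x s 0) = fun s : ℝ ↦ Φ (v + s • z) := by
    funext s; simp only [hx, zero_smul, add_zero]
  have hL : (fun s : ℝ ↦ velocity I (x s) 0) =
      fun s : ℝ ↦ (mfderiv 𝓘(ℝ, V) I Φ (v + s • z) u : E) := by
    funext s; exact velocity_comp_lineAt_zero (hΦd _) u
  have hRc : x 0 = fun t : ℝ ↦ Φ (v + t • u) := by
    funext t; simp only [hx, zero_smul, add_zero]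
  have hR : (fun t : ℝ ↦ velocity I (fun s ↦ x s t) 0) =
      fun t : ℝ ↦ (mfderiv 𝓘(ℝ, V) I Φ (v + t • u) z : E) := by
    funext t
    have h1 : (fun s ↦ x s t) = fun s : ℝ ↦ Φ ((v + t • u) + s • z) := by
      funext s; simp only [hx]; congr 1; abel
    rw [h1]
    exact velocity_comp_lineAt_zero (hΦd _) z
  show covariantDerivAlong cov (fun s : ℝ ↦ Φ (v + s • z))
      (fun s : ℝ ↦ mfderiv 𝓘(ℝ, V) I Φ (v + s • z) u) 0 =
    covariantDerivAlong cov (fun s : ℝ ↦ Φ (v + s • u))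
      (fun s : ℝ ↦ mfderiv 𝓘(ℝ, V) I Φ (v + s • u) z) 0
  rw [← hLc, ← hL, hsymm, hR, hRc]

/-- **Additivity `A_v(z, u + u') = A_v(z, u) + A_v(z, u')`** (`dΦ(u + u') = dΦ u + dΦ u'` and
additivity of the induced covariant derivative). [folklore] -/
theorem covariantDerivAlong_mfderiv_tubeMap_add (hc : IsGeodesicallyComplete cov)
    (hs : ContMDiff (𝓘(ℝ, ℝ).prod 𝓘(ℝ, V)) I.tangent ∞
      (fun q : ℝ × V ↦ (TotalSpace.mk' E (c q.1) (e q.1 q.2) : TangentBundle I M)))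
    (v z u u' : V) :
    covariantDerivAlong cov
      (fun s : ℝ ↦ expMap cov (c ⟪ε₀, v + s • z⟫) (e ⟪ε₀, v + s • z⟫ (v + s • z - ⟪ε₀, v + s • z⟫ • ε₀)))
      (fun s : ℝ ↦ mfderiv 𝓘(ℝ, V) I
        (fun v : V ↦ expMap cov (c ⟪ε₀, v⟫) (e ⟪ε₀, v⟫ (v - ⟪ε₀, v⟫ • ε₀))) (v + s • z) (u + u')) 0 =
    covariantDerivAlong cov
      (fun s : ℝ ↦ expMap cov (c ⟪ε₀, v + s • z⟫) (e ⟪ε₀, v + s • z⟫ (v + s • z - ⟪ε₀, v + s • z⟫ • ε₀)))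
      (fun s : ℝ ↦ mfderiv 𝓘(ℝ, V) I
        (fun v : V ↦ expMap cov (c ⟪ε₀, v⟫) (e ⟪ε₀, v⟫ (v - ⟪ε₀, v⟫ • ε₀))) (v + s • z) u) 0 +
    covariantDerivAlong cov
      (fun s : ℝ ↦ expMap cov (c ⟪ε₀, v + s • z⟫) (e ⟪ε₀, v + s • z⟫ (v + s • z - ⟪ε₀, v + s • z⟫ • ε₀)))
      (fun s : ℝ ↦ mfderiv 𝓘(ℝ, V) I
        (fun v : V ↦ expMap cov (c ⟪ε₀, v⟫) (e ⟪ε₀, v⟫ (v - ⟪ε₀, v⟫ • ε₀))) (v + s • z) u') 0 := by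
  set Φ : V → M := fun v : V ↦ expMap cov (c ⟪ε₀, v⟫) (e ⟪ε₀, v⟫ (v - ⟪ε₀, v⟫ • ε₀)) with hΦ
  have hfield : (fun s : ℝ ↦ mfderiv 𝓘(ℝ, V) I Φ (v + s • z) (u + u')) =
      fun s : ℝ ↦ mfderiv 𝓘(ℝ, V) I Φ (v + s • z) u + mfderiv 𝓘(ℝ, V) I Φ (v + s • z) u' := by
    funext s
    exact (mfderiv 𝓘(ℝ, V) I Φ (v + s • z)).map_add u u'
  show covariantDerivAlong cov (fun s : ℝ ↦ Φ (v + s • z))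
      (fun s : ℝ ↦ mfderiv 𝓘(ℝ, V) I Φ (v + s • z) (u + u')) 0 = _
  rw [hfield]
  exact covariantDerivAlong_add_holds (cov := cov)
    (mdifferentiableAt_lift_mfderiv_tubeMap (cov := cov) hc hs v z u)
    (mdifferentiableAt_lift_mfderiv_tubeMap (cov := cov) hc hs v z u')

/-- **Homogeneity `A_v(z, t u) = t A_v(z, u)`** (`dΦ(t u) = t dΦ u` and the Leibniz rule with a
constant factor). [folklore] -/
theorem covariantDerivAlong_mfderiv_tubeMap_smul (hc : IsGeodesicallyComplete cov)
    (hs : ContMDiff (𝓘(ℝ, ℝ).prod 𝓘(ℝ, V)) I.tangent ∞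
      (fun q : ℝ × V ↦ (TotalSpace.mk' E (c q.1) (e q.1 q.2) : TangentBundle I M)))
    (v z u : V) (t : ℝ) :
    covariantDerivAlong cov
      (fun s : ℝ ↦ expMap cov (c ⟪ε₀, v + s • z⟫) (e ⟪ε₀, v + s • z⟫ (v + s • z - ⟪ε₀, v + s • z⟫ • ε₀)))
      (fun s : ℝ ↦ mfderiv 𝓘(ℝ, V) I
        (fun v : V ↦ expMap cov (c ⟪ε₀, v⟫) (e ⟪ε₀, v⟫ (v - ⟪ε₀, v⟫ • ε₀))) (v + s • z) (t • u)) 0 =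
    t • covariantDerivAlong cov
      (fun s : ℝ ↦ expMap cov (c ⟪ε₀, v + s • z⟫) (e ⟪ε₀, v + s • z⟫ (v + s • z - ⟪ε₀, v + s • z⟫ • ε₀)))
      (fun s : ℝ ↦ mfderiv 𝓘(ℝ, V) I
        (fun v : V ↦ expMap cov (c ⟪ε₀, v⟫) (e ⟪ε₀, v⟫ (v - ⟪ε₀, v⟫ • ε₀))) (v + s • z) u) 0 := by
  set Φ : V → M := fun v : V ↦ expMap cov (c ⟪ε₀, v⟫) (e ⟪ε₀, v⟫ (v - ⟪ε₀, v⟫ • ε₀)) with hΦ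
  have hfield : (fun s : ℝ ↦ mfderiv 𝓘(ℝ, V) I Φ (v + s • z) (t • u)) =
      fun s : ℝ ↦ (fun _ : ℝ ↦ t) s • mfderiv 𝓘(ℝ, V) I Φ (v + s • z) u := by
    funext s
    exact (mfderiv 𝓘(ℝ, V) I Φ (v + s • z)).map_smul t u
  show covariantDerivAlong cov (fun s : ℝ ↦ Φ (v + s • z))
      (fun s : ℝ ↦ mfderiv 𝓘(ℝ, V) I Φ (v + s • z) (t • u)) 0 = _
  rw [hfield, covariantDerivAlong_smul_holds (cov := cov) (f := fun _ : ℝ ↦ t)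
    (differentiableAt_const t) (mdifferentiableAt_lift_mfderiv_tubeMap (cov := cov) hc hs v z u)]
  simp only [deriv_const', zero_smul, zero_add]
  rfl

/-! ### The metric derivative on the axis, in Riesz form -/

variable [CompleteSpace V] {n : ℕ∞ω} [Fact (1 ≤ n)]
  (g : PseudoRiemannianMetric I n E (TangentSpace I : M → Type _)) [g.HasLeviCivita]
  [CovariantDerivative.ContMDiffCovariantDerivative g.leviCivita 1]
  [CovariantDerivative.ContMDiffCovariantDerivative g.leviCivita ((⊤ : ℕ∞) : ℕ∞ω)]

omit [CovariantDerivative.ContMDiffCovariantDerivative cov 1]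
  [CovariantDerivative.ContMDiffCovariantDerivative cov ((⊤ : ℕ∞) : ℕ∞ω)] in
/-- **`d/ds|₀ g(dΦ_{x₁ε₀+sz} u, dΦ_{x₁ε₀+sz} w) = ⟪B z u, w⟫ + ⟪u, B z w⟫`** on the axis, with the
Riesz vectors `⟪B z u, w⟫ = g(A(z, u), e(x₁) w)` of the second-order data
(`hasDerivAt_val_mfderiv_tubeMap`, `dΦ_{x₁ε₀} = e(x₁)` for an adapted frame, symmetry of `g`).
This is the hypothesis `hD` of `christoffel_eq_of_fderiv_eq` for the tube metric on the axis.
[cite: LeeRiemannianManifolds2018, Prop. 5.26] -/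
theorem hasDerivAt_val_mfderiv_tubeMap_axis (hgc : IsGeodesicallyComplete g.leviCivita)
    (hs : ContMDiff (𝓘(ℝ, ℝ).prod 𝓘(ℝ, V)) I.tangent ∞
      (fun q : ℝ × V ↦ (TotalSpace.mk' E (c q.1) (e q.1 q.2) : TangentBundle I M)))
    (hε₀ : ‖ε₀‖ = 1) (he₀ : ∀ t, e t ε₀ = (velocity I c t : E)) (x₁ : ℝ) (z u w : V) :
    HasDerivAt (fun s : ℝ ↦
      g.val (expMap g.leviCivita (c ⟪ε₀, x₁ • ε₀ + s • z⟫)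
          (e ⟪ε₀, x₁ • ε₀ + s • z⟫ (x₁ • ε₀ + s • z - ⟪ε₀, x₁ • ε₀ + s • z⟫ • ε₀)))
        (mfderiv 𝓘(ℝ, V) I (fun v : V ↦ expMap g.leviCivita (c ⟪ε₀, v⟫)
          (e ⟪ε₀, v⟫ (v - ⟪ε₀, v⟫ • ε₀))) (x₁ • ε₀ + s • z) u)
        (mfderiv 𝓘(ℝ, V) I (fun v : V ↦ expMap g.leviCivita (c ⟪ε₀, v⟫)
          (e ⟪ε₀, v⟫ (v - ⟪ε₀, v⟫ • ε₀))) (x₁ • ε₀ + s • z) w))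
      (⟪(toDual ℝ V).symm ((g.val (c x₁) (covariantDerivAlong g.leviCivita
            (fun s : ℝ ↦ expMap g.leviCivita (c ⟪ε₀, x₁ • ε₀ + s • z⟫)
              (e ⟪ε₀, x₁ • ε₀ + s • z⟫ (x₁ • ε₀ + s • z - ⟪ε₀, x₁ • ε₀ + s • z⟫ • ε₀)))
            (fun s : ℝ ↦ mfderiv 𝓘(ℝ, V) I (fun v : V ↦ expMap g.leviCivita (c ⟪ε₀, v⟫)
              (e ⟪ε₀, v⟫ (v - ⟪ε₀, v⟫ • ε₀))) (x₁ • ε₀ + s • z) u) 0)).comp (e x₁)), w⟫ +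
        ⟪u, (toDual ℝ V).symm ((g.val (c x₁) (covariantDerivAlong g.leviCivita
            (fun s : ℝ ↦ expMap g.leviCivita (c ⟪ε₀, x₁ • ε₀ + s • z⟫)
              (e ⟪ε₀, x₁ • ε₀ + s • z⟫ (x₁ • ε₀ + s • z - ⟪ε₀, x₁ • ε₀ + s • z⟫ • ε₀)))
            (fun s : ℝ ↦ mfderiv 𝓘(ℝ, V) I (fun v : V ↦ expMap g.leviCivita (c ⟪ε₀, v⟫)
              (e ⟪ε₀, v⟫ (v - ⟪ε₀, v⟫ • ε₀))) (x₁ • ε₀ + s • z) w) 0)).comp (e x₁))⟫) 0 := by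
  set Φ : V → M := fun v : V ↦ expMap g.leviCivita (c ⟪ε₀, v⟫) (e ⟪ε₀, v⟫ (v - ⟪ε₀, v⟫ • ε₀))
    with hΦ
  have h := hasDerivAt_val_mfderiv_tubeMap (c := c) (e := e) (ε₀ := ε₀) g hgc hs (x₁ • ε₀) z u w
  refine h.congr_deriv ?_
  -- the base point and the differential at `s = 0` are those of the axis
  have hpt0 : x₁ • ε₀ + (0 : ℝ) • z = x₁ • ε₀ := by rw [zero_smul, add_zero]
  have hbase : Φ (x₁ • ε₀ + (0 : ℝ) • z) = c x₁ := by
    rw [hpt0]; exact tubeMap_axis (cov := g.leviCivita) (e := e) hε₀ x₁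
  have hdu : (mfderiv 𝓘(ℝ, V) I Φ (x₁ • ε₀ + (0 : ℝ) • z) u : E) = e x₁ u := by
    rw [hpt0]; exact mfderiv_tubeMap_axis_apply (cov := g.leviCivita) hgc hs hε₀ he₀ x₁ u
  have hdw : (mfderiv 𝓘(ℝ, V) I Φ (x₁ • ε₀ + (0 : ℝ) • z) w : E) = e x₁ w := by
    rw [hpt0]; exact mfderiv_tubeMap_axis_apply (cov := g.leviCivita) hgc hs hε₀ he₀ x₁ w
  show g.val (Φ (x₁ • ε₀ + (0 : ℝ) • z)) _ (mfderiv 𝓘(ℝ, V) I Φ (x₁ • ε₀ + (0 : ℝ) • z) w) +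
      g.val (Φ (x₁ • ε₀ + (0 : ℝ) • z)) (mfderiv 𝓘(ℝ, V) I Φ (x₁ • ε₀ + (0 : ℝ) • z) u) _ = _
  rw [hdu, hdw, hbase]
  conv_rhs => arg 2; rw [real_inner_comm]
  rw [toDual_symm_apply, toDual_symm_apply, ContinuousLinearMap.comp_apply,
    ContinuousLinearMap.comp_apply, g.symm (c x₁) (e x₁ u)]

end Literature.Geometry.Riemannian

end
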